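import Literature.NumberTheory.EllipticCurves.ManinConstantMultiplicativePrimesProofs
import HarnessLib

/-!
# A parameter of finite height with rational logarithmic multiplier and bounded denominators is
# integral (the local step of the finite-height route, model-free, every prime; proofs only)

Topic `NumberTheory/EllipticCurves` (theorems only; no definition, no named fact). The local
mechanism of the finite-height route to the integrality of the Manin constant
(`NeronIsogenyScaling.lean`, "A finite-height refinement": the local lemma plus
`[pᵐ]_{Ŵ'}(t') ∈ ℤ_p⟦q⟧`), isolated from every choice of model and valid at EVERY prime `p`.
For a Weierstrass equation `V/ℤ_p` (generic fibre `W = V ⊗ ℚ_p`) with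

* (i) FINITE HEIGHT `[p]˜ ≠ 0` for the reduction `V ⊗ 𝔽_p`,
* (ii) a `p`-integral series `ψ ∈ Xℤ_p⟦X⟧` (in the application Honda's witness,
  `log_W(ψ) = Σ aₙXⁿ/n`),
* a series `t ∈ Xℚ_p⟦X⟧` with `log_W(t) = u · log_W(ψ)` for a nonzero RATIONAL `u`, and
* bounded denominators: `t · Q = P` for some `P, Q ∈ ℤ_p⟦X⟧`, `Q ≠ 0`,

the series `t` is `p`-integral (`norm_coeff_le_one_of_formalLog_subst_eq_C_mul`); in particular
its linear coefficient `u · [X¹]ψ` is (`norm_ratCast_mul_le_one_of_formalLog_subst_eq_C_mul`), so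
`‖u‖_p ≤ 1` when `ψ = X + ⋯` (`norm_ratCast_le_one_of_formalLog_subst_eq_C_mul`). Proof
(steps 7–9 of `padicNorm_le_one_of_neronLattice_eq_smul_periodLattice_of_formalMul_ne_zero`, with
the transport `θ₀` replaced by the identity): `u = ±n₁/d` in lowest terms gives
`log_W([d]t) = ±n₁ log_W(ψ) = log_W([n₁](ψ^{±}))` (`ψ⁻ = i_W(ψ)`, also integral), so
`[d]_W(t) = [n₁]_W(ψ^{±}) ∈ ℤ_p⟦X⟧` (`eq_of_formalLog_subst_eq`); `[d]_V` has a unit coefficient in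
positive degree (finite height, `exists_isUnit_coeff_formalMul_subst_of_formalMul_prime_ne_zero`),
and the Weierstrass-preparation lemma
`Literature.RingTheory.PowerSeries.padicInt_exists_map_eq_of_subst_eq_map` turns `t ∈ Frac ℤ_p⟦X⟧`
into `t ∈ ℤ_p⟦X⟧`.

This is what the two remaining finite-height cases `p = 2, 3` of the fact
`edixhoven_int_of_neronLattice_eq_smul_periodLattice` need on the formal-group side (inputs (i),
(ii) exist at every good prime by `FormalGroupFrobeniusTypeAllPrimesProofs`,
`HondaStrongIsomorphismAllPrimesProofs`, and at every multiplicative prime by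
`NodalReductionHondaTypeProofs`, `HondaStrongIsomorphismMultiplicativeProofs`); what they still need
on the modular side is the parameter `t' = −x'/y'` of the MINIMAL model along the parametrisation
with its bounded denominators (the `(x, y)`-dictionary for `z_L`), in place of the short-model
transport `θ₀(u z_L)` which is `p`-integral only for `p ≥ 5`.

## References

* T. Honda, *On the theory of commutative formal groups*, J. Math. Soc. Japan 22 (1970), Thm. 2
  (p. 223), Thm. 9 (pp. 240–241). [Honda1970]
* B. Edixhoven, *On the Manin constants of modular elliptic curves* (1991), Prop. 2.
  [EdixhovenManin1991]
* J. H. Silverman, *The Arithmetic of Elliptic Curves*, 2nd ed. (2009), IV.2–IV.7.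
  [cite: SilvermanAEC2009]
-/

noncomputable section

open scoped Classical

namespace WeierstrassCurve

open PowerSeries Literature.RingTheory.FormalGroups Literature.NumberTheory.EllipticCurves

variable {p : ℕ} [hp : Fact p.Prime] (V : WeierstrassCurve ℤ_[p])

/-- **Positive multiplier.** For `V/ℤ_p` with `[p]˜ ≠ 0`, a `p`-integral `ψ ∈ Xℚ_p⟦X⟧`, a rational
`u > 0`, and `t ∈ Xℚ_p⟦X⟧` with `log_W(t) = u · log_W(ψ)` (`W = V ⊗ ℚ_p`) and `t · Q = P`,
`P, Q ∈ ℤ_p⟦X⟧`, `Q ≠ 0`: every coefficient of `t` is a `p`-adic integer. (`u = n₁/d`: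
`[d]_W(t) = [n₁]_W(ψ) ∈ ℤ_p⟦X⟧`, finite height of `[d]`, Weierstrass preparation.)
[cite: Honda1970, Thm. 2 (p. 223)] -/
theorem norm_coeff_le_one_of_formalLog_subst_eq_C_mul_of_pos
    (hfin : (V.map PadicInt.toZMod).formalMul p ≠ 0)
    {ψ : ℚ_[p]⟦X⟧} (hψ0 : constantCoeff ψ = 0) (hψi : ∀ n, ‖coeff n ψ‖ ≤ 1)
    {t : ℚ_[p]⟦X⟧} (ht0 : constantCoeff t = 0) {u : ℚ} (hu : 0 < u)
    (hlog : (V.map PadicInt.Coe.ringHom).formalLog.subst t =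
      C (u : ℚ_[p]) * (V.map PadicInt.Coe.ringHom).formalLog.subst ψ)
    {P Q : ℤ_[p]⟦X⟧} (hQ : Q ≠ 0)
    (hPQ : t * Q.map (algebraMap ℤ_[p] ℚ_[p]) = P.map (algebraMap ℤ_[p] ℚ_[p])) (k : ℕ) :
    ‖coeff k t‖ ≤ 1 := by
  haveI := V.isIntegral_map_coe
  set W := V.map PadicInt.Coe.ringHom with hWdef
  have hts : HasSubst t := HasSubst.of_constantCoeff_zero' ht0
  have hψs : HasSubst ψ := HasSubst.of_constantCoeff_zero' hψ0
  have hψI : IsPadicInt ψ := isPadicInt_iff_coeff.mpr hψi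
  -- `u = n₁ / d` in lowest terms
  set d : ℕ := u.den with hd
  have hd0 : 0 < d := u.den_pos
  have hnum : 0 < u.num := Rat.num_pos.mpr hu
  set n₁ : ℕ := u.num.toNat with hn₁
  have hn₁z : ((n₁ : ℕ) : ℤ) = u.num := Int.toNat_of_nonneg hnum.le
  have hdu : (d : ℚ_[p]) * (u : ℚ_[p]) = (n₁ : ℚ_[p]) := by
    have h : u * d = (u.num : ℚ) := Rat.mul_den_eq_num _
    rw [← hn₁z] at h
    have h' := congrArg (fun r : ℚ ↦ (r : ℚ_[p])) h
    simp only [Rat.cast_mul, Rat.cast_natCast, Int.cast_natCast] at h'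
    rw [mul_comm]
    exact h'
  -- `w = [n₁](ψ) ∈ ℤ_p⟦X⟧`
  set w : ℚ_[p]⟦X⟧ := (W.formalMul n₁).subst ψ with hw
  have hwI : IsPadicInt w := (W.isPadicInt_formalMul n₁).powerSeries_subst hψI hψs
  have hw0 : constantCoeff w = 0 :=
    (Literature.NumberTheory.EllipticCurves.constantCoeff_subst_of_constantCoeff_eq_zero hψ0).trans (W.constantCoeff_formalMul n₁)
  have hlogw : W.formalLog.subst w = n₁ • W.formalLog.subst ψ := by
    rw [hw, ← subst_comp_subst_apply (W.hasSubst_formalMul n₁) hψs, W.formalLog_subst_formalMul n₁,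
      ← coe_substAlgHom hψs, map_nsmul, coe_substAlgHom]
  -- `[d](t)` has the same logarithm, hence `[d](t) = w`
  have hdt0 : constantCoeff ((W.formalMul d).subst t) = 0 :=
    (Literature.NumberTheory.EllipticCurves.constantCoeff_subst_of_constantCoeff_eq_zero ht0).trans (W.constantCoeff_formalMul d)
  have hlogd : W.formalLog.subst ((W.formalMul d).subst t) = n₁ • W.formalLog.subst ψ := by
    rw [← subst_comp_subst_apply (W.hasSubst_formalMul d) hts, W.formalLog_subst_formalMul d,
      ← coe_substAlgHom hts, map_nsmul, coe_substAlgHom, hlog, nsmul_eq_mul, nsmul_eq_mul,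
      ← mul_assoc, ← map_natCast (C : ℚ_[p] →+* ℚ_[p]⟦X⟧) d, ← map_mul, hdu, map_natCast]
  have hGw : (W.formalMul d).subst t = w :=
    W.eq_of_formalLog_subst_eq hdt0 hw0 (hlogd.trans hlogw.symm)
  -- integral lift `[d]_V` with a unit coefficient in positive degree (finite height)
  have halg : (algebraMap ℤ_[p] ℚ_[p] : ℤ_[p] →+* ℚ_[p]) = PadicInt.Coe.ringHom := rfl
  obtain ⟨w₁, hw₁⟩ := isPadicInt_iff_exists_powerSeries_map.mp hwI
  have hG₁ : (V.formalMul d).map PadicInt.Coe.ringHom = W.formalMul d := by rw [map_formalMul]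
  obtain ⟨dd, hdd, hunit⟩ := V.exists_isUnit_coeff_formalMul_subst_of_formalMul_prime_ne_zero hfin hd0
    (θ := X) constantCoeff_X (by rw [coeff_one_X]; exact isUnit_one)
  rw [powerSeries_subst_X_self] at hunit
  have hGz : (V.formalMul d).subst t = w₁.map (algebraMap ℤ_[p] ℚ_[p]) := by
    rw [← subst_map_algebraMap (V.formalMul d) hts, halg, hG₁, hGw, ← hw₁]
  obtain ⟨t₁, ht₁⟩ :=
    Literature.RingTheory.PowerSeries.padicInt_exists_map_eq_of_subst_eq_map hdd hunit ht0 hGz hQ hPQ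
  rw [← ht₁, coeff_map]
  exact PadicInt.norm_le_one _

/-- **A parameter of finite height with nonzero rational logarithmic multiplier and bounded
denominators is integral (every prime `p`, no model hypothesis).** For `V/ℤ_p` with `[p]˜ ≠ 0`
(finite height), a `p`-integral `ψ ∈ Xℚ_p⟦X⟧`, a rational `u ≠ 0`, and `t ∈ Xℚ_p⟦X⟧` with
`log_W(t) = u · log_W(ψ)` (`W = V ⊗ ℚ_p`) and `t · Q = P` for some `P, Q ∈ ℤ_p⟦X⟧`, `Q ≠ 0`:
`t ∈ ℤ_p⟦X⟧`. (For `u < 0` replace `ψ` by `i_W(ψ)`, `log_W(i_W ψ) = −log_W ψ`.) This is the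
local step of the finite-height route to Edixhoven's integrality of the Manin constant, free of the
short model (hence of `p ≥ 5`). [cite: Honda1970, Thm. 2 (p. 223)] -/
theorem norm_coeff_le_one_of_formalLog_subst_eq_C_mul
    (hfin : (V.map PadicInt.toZMod).formalMul p ≠ 0)
    {ψ : ℚ_[p]⟦X⟧} (hψ0 : constantCoeff ψ = 0) (hψi : ∀ n, ‖coeff n ψ‖ ≤ 1)
    {t : ℚ_[p]⟦X⟧} (ht0 : constantCoeff t = 0) {u : ℚ} (hu : u ≠ 0)
    (hlog : (V.map PadicInt.Coe.ringHom).formalLog.subst t =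
      C (u : ℚ_[p]) * (V.map PadicInt.Coe.ringHom).formalLog.subst ψ)
    {P Q : ℤ_[p]⟦X⟧} (hQ : Q ≠ 0)
    (hPQ : t * Q.map (algebraMap ℤ_[p] ℚ_[p]) = P.map (algebraMap ℤ_[p] ℚ_[p])) (k : ℕ) :
    ‖coeff k t‖ ≤ 1 := by
  rcases lt_or_gt_of_ne hu with hneg | hpos
  · -- `u < 0`: use `ψ⁻ = i_W(ψ)`
    haveI := V.isIntegral_map_coe
    set W := V.map PadicInt.Coe.ringHom with hWdef
    have hψs : HasSubst ψ := HasSubst.of_constantCoeff_zero' hψ0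
    have hψI : IsPadicInt ψ := isPadicInt_iff_coeff.mpr hψi
    set ψ' : ℚ_[p]⟦X⟧ := W.formalNeg.subst ψ with hψ'
    have hψ'0 : constantCoeff ψ' = 0 :=
      (Literature.NumberTheory.EllipticCurves.constantCoeff_subst_of_constantCoeff_eq_zero hψ0).trans W.constantCoeff_formalNeg
    have hψ'I : IsPadicInt ψ' := W.isPadicInt_formalNeg.powerSeries_subst hψI hψs
    have hlog' : W.formalLog.subst ψ' = -W.formalLog.subst ψ := by
      rw [hψ', ← subst_comp_subst_apply (HasSubst.of_constantCoeff_zero' W.constantCoeff_formalNeg) hψs,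
        W.formalLog_subst_formalNeg, ← coe_substAlgHom hψs, map_neg, coe_substAlgHom]
    refine V.norm_coeff_le_one_of_formalLog_subst_eq_C_mul_of_pos hfin hψ'0 (isPadicInt_iff_coeff.mp hψ'I)
      ht0 (u := -u) (by linarith) ?_ hQ hPQ k
    rw [hlog, ← hWdef, hlog', Rat.cast_neg, map_neg]
    ring
  · exact V.norm_coeff_le_one_of_formalLog_subst_eq_C_mul_of_pos hfin hψ0 hψi ht0 hpos hlog hQ hPQ k

/-- **The multiplier read on the linear coefficient**: under the same hypotheses,
`‖u · [X¹]ψ‖_p ≤ 1` (`[X¹]t = u · [X¹]ψ`, since `log_W = X + ⋯`). [cite: Honda1970, Thm. 2 (p. 223)] -/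
theorem norm_ratCast_mul_le_one_of_formalLog_subst_eq_C_mul
    (hfin : (V.map PadicInt.toZMod).formalMul p ≠ 0)
    {ψ : ℚ_[p]⟦X⟧} (hψ0 : constantCoeff ψ = 0) (hψi : ∀ n, ‖coeff n ψ‖ ≤ 1)
    {t : ℚ_[p]⟦X⟧} (ht0 : constantCoeff t = 0) {u : ℚ} (hu : u ≠ 0)
    (hlog : (V.map PadicInt.Coe.ringHom).formalLog.subst t =
      C (u : ℚ_[p]) * (V.map PadicInt.Coe.ringHom).formalLog.subst ψ)
    {P Q : ℤ_[p]⟦X⟧} (hQ : Q ≠ 0)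
    (hPQ : t * Q.map (algebraMap ℤ_[p] ℚ_[p]) = P.map (algebraMap ℤ_[p] ℚ_[p])) :
    ‖(u : ℚ_[p]) * coeff 1 ψ‖ ≤ 1 := by
  have h1 := congrArg (coeff 1) hlog
  rw [coeff_one_subst_eq_mul _ ht0, coeff_one_formalLog, one_mul, coeff_C_mul,
    coeff_one_subst_eq_mul _ hψ0, coeff_one_formalLog, one_mul] at h1
  rw [← h1]
  exact V.norm_coeff_le_one_of_formalLog_subst_eq_C_mul hfin hψ0 hψi ht0 hu hlog hQ hPQ 1

/-- **`‖u‖_p ≤ 1` when the witness is normalised, `ψ = X + ⋯`** (as for Honda's witness of a curve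
over `ℚ`, `a₁ = 1`): the shape in which the finite-height route concludes `‖q‖_p ≤ 1` for the
Manin-type scalar. [cite: Honda1970, Thm. 2 (p. 223)] [cite: EdixhovenManin1991, Prop. 2] -/
theorem norm_ratCast_le_one_of_formalLog_subst_eq_C_mul
    (hfin : (V.map PadicInt.toZMod).formalMul p ≠ 0)
    {ψ : ℚ_[p]⟦X⟧} (hψ0 : constantCoeff ψ = 0) (hψ1 : coeff 1 ψ = 1) (hψi : ∀ n, ‖coeff n ψ‖ ≤ 1)
    {t : ℚ_[p]⟦X⟧} (ht0 : constantCoeff t = 0) {u : ℚ} (hu : u ≠ 0)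
    (hlog : (V.map PadicInt.Coe.ringHom).formalLog.subst t =
      C (u : ℚ_[p]) * (V.map PadicInt.Coe.ringHom).formalLog.subst ψ)
    {P Q : ℤ_[p]⟦X⟧} (hQ : Q ≠ 0)
    (hPQ : t * Q.map (algebraMap ℤ_[p] ℚ_[p]) = P.map (algebraMap ℤ_[p] ℚ_[p])) :
    ‖(u : ℚ_[p])‖ ≤ 1 := by
  have h := V.norm_ratCast_mul_le_one_of_formalLog_subst_eq_C_mul hfin hψ0 hψi ht0 hu hlog hQ hPQ
  rwa [hψ1, mul_one] at h

end WeierstrassCurve
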